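import Summits.BirchSwinnertonDyer.BirchSwinnertonDyer.Theorems.KimAtThreeDeepUpperExpStarFacts
import Literature.NumberTheory.PAdicHodge.DeRhamBaseChangeProofs
import HarnessLib

/-!
# The `exp*`-side cite facts at the FACTOR FIELDS `L ⊇ ℚ_v` (tower representation): `V_pW|_{Γ_L}` de Rham and
# the Prop-1.2.3 binders `hinj`/`hex` for `exp*_ω` over `L`, from the Literature facts
# (route `KimAtThreeKolyvagin`, rung W2, cruxes 19076 / 19560; cell `bsd-addord`, seat w2-c3 gen 8)

HONEST FRAMING. Theorems only (local instances on `ℚ_v` as in `KimAtThreeDeepLowerExpStarOmegaPlace`); nothing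
is closed or booked; BSD is not proved by any of this. WANTED by the 19560 LEAD (kim3 g15, STATUS
2026-08-27T07:21:10Z (3)): the per-factor clauses of the Kato-side packages (kim3's hKdef₀ / hLog₀ / displayed
Kato-v2, w2-c3's X1-int_b via (DEF)/(RES)/(LAT)) live on the TOWER representation
`localRationalTateRep W p ((galRestrictPlace v).comp (absGaloisRestrict ℚ_v L))` of a factor field `L = L_w ⊇ ℚ_v`
and display there the Prop-1.2.3 binders `hinjw` / `hexw` of `expStarOmega` over `L`. They follow from the cite
facts of `Literature/NumberTheory/PAdicHodge/DualExpElliptic.lean` (p504202):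

* `isDeRham_localRationalTateRep_comp_of_facts` — **`V_pW|_{Γ_L}` (tower) is de Rham**: the fact
  `isDeRham_restrictedRationalTateRep` at `F = ℚ_v` (`restrictedRationalTateRep W ℚ_v p` IS
  `localRationalTateRep W p (galRestrictPlace v)`, `rfl`) transported along the continuous embedding `ℚ_v → L` by
  the tree's PROVED `PAdicHodge.isAdmissible_bdR_restrictField` (Brinon–Conrad Prop. 6.3.8: restriction to `Γ_L`
  of a de Rham representation is de Rham), the restricted representation being DEFINITIONALLY the tower one
  (`localRationalTateRep_comp`);
* `hinj_hex_comp_of_facts` — **`hinjw ∧ hexw`** at `L` from Kato's Prop. 1.2.3 (`cupLogInjective_and_hasDualExp_of_isDeRham`,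
  stated for ANY de Rham representation) and the previous theorem.

The `ℚ_p`-algebra structures are the canonical ones (`padicAlgebraPlace` on `ℚ_v`, `LocalField.padicAlgebra L p hL`
on `L`, as in kim3's texts: `LocalField.adicCompletionPadicAlgebra w.1 3 _`), and `algebraMap ℚ_v L` is assumed
continuous (true for the completions `L_w` of `ℚ(ζ_m)` over `ℚ_v`, supplied by the per-factor lanes). Together with
w2-c2's `nonempty_localNeronLine_comp_of_nonempty_neronDeRhamDatum` (line datum at the tower, p504477) and
`exists_localNeronLine_expStarOmega_res` ((RES), p504608), every `exp*`-side binder displayed at a factor field is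
now a consequence of cite facts + `nonempty_neronDeRhamDatum`.
References: [Kato1993LNM1553] Ch. II Prop. 1.2.3, Ex. 1.3.5; [BrinonConrad2009] Prop. 6.3.8;
[FontaineAsterisque223III] Exp. III Thm. 1.5.2.
-/

set_option autoImplicit false
-- the Theorems namespace of a single-conjunct summit repeats the summit name by design (D-0017)
set_option linter.dupNamespace false

noncomputable section

open scoped NumberField
open Field ValuativeRel IsDedekindDomain NumberField
open Literature.NumberTheory.GaloisRepresentations
open Literature.NumberTheory.GaloisRepresentations.PeriodRingData
open Literature.NumberTheory.GaloisRepresentations.IsNonarchimedeanLocalField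
open Literature.NumberTheory.PAdicHodge
open Literature.NumberTheory.EllipticCurves WeierstrassCurve
open Summit.BirchSwinnertonDyer.BirchSwinnertonDyer.Theorems.KimAtThreeDeepLowerExpStarOmega
open Summit.BirchSwinnertonDyer.BirchSwinnertonDyer.Theorems.KimAtThreeDeepLowerExpStarOmegaPlace
open Summit.BirchSwinnertonDyer.BirchSwinnertonDyer.Theorems.KimAtThreeDeepUpperExpStarFacts

namespace Summit.BirchSwinnertonDyer.BirchSwinnertonDyer.Theorems.KimAtThreeDeepUpperExpStarFactsTower

variable (W : WeierstrassCurve ℚ) [W.IsElliptic] (p : ℕ) [Fact p.Prime]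
  (v : HeightOneSpectrum (𝓞 ℚ)) [hv : Fact (((p : ℕ) : 𝓞 ℚ) ∈ v.asIdeal)]

attribute [local instance 100000] NumberField.Place.instAlgebraCompletion
attribute [local instance] valuativeRelPlace topologicalSpacePlace
attribute [local instance] isNonarchimedeanLocalField_place charZero_place
attribute [local instance] padicAlgebraPlace fact_not_isUnit_place isAdicComplete_place

variable {L : Type} [Field L] [ValuativeRel L] [TopologicalSpace L] [IsNonarchimedeanLocalField L]
  [CharZero L] [Algebra (Place.Completion (Sum.inr v : Place ℚ)) L]
  [Fact (¬ IsUnit (p : integerC L))] [IsAdicComplete (Ideal.span {(p : integerC L)}) (integerC L)]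
  (hL : valuation L p < 1)

/-- **`V_pW|_{Γ_L}` along the tower `Γ_L → Γ_{ℚ_v} → Γ_ℚ` is de Rham** (for the canonical `ℚ_p`-structure
`LocalField.padicAlgebra L p hL`), from the cite fact `isDeRham_restrictedRationalTateRep` at `ℚ_v` and the tree's
`isAdmissible_bdR_restrictField` along the continuous embedding `ℚ_v → L`.
[cite: Kato1993LNM1553, Ch. II Ex. 1.3.5] [cite: BrinonConrad2009, Prop. 6.3.8] -/
theorem isDeRham_localRationalTateRep_comp_of_facts (hDR : isDeRham_restrictedRationalTateRep)
    (hcont : Continuous (algebraMap (Place.Completion (Sum.inr v : Place ℚ)) L)) :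
    letI := LocalField.padicAlgebra L p hL
    GaloisRep.IsDeRham (bdRPeriodRingData (F := L) (p := p) hL)
      (localRationalTateRep W p
        ((galRestrictPlace v).comp (absGaloisRestrict (Place.Completion (Sum.inr v : Place ℚ)) L))) := by
  letI := LocalField.padicAlgebra L p hL
  haveI : Module.Finite ℚ_[p] (W.rationalTateModule p) :=
    WeierstrassCurve.module_finite_rationalTateModule_holds W p
  have hK : GaloisRep.IsDeRham (bdRPeriodRingData (valuation_place_lt_one p v))
      (localRationalTateRep W p (galRestrictPlace v)) :=
    hDR W (F := Place.Completion (Sum.inr v : Place ℚ)) (valuation_place_lt_one p v)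
  exact isAdmissible_bdR_restrictField (K := Place.Completion (Sum.inr v : Place ℚ)) (L := L) (ℓ := p) hcont
    (valuation_place_lt_one p v) hL (padicAlgebraPlace p v) _ rfl rfl (LocalField.padicAlgebra L p hL) _ rfl rfl
    (localRationalTateRep W p (galRestrictPlace v)) hK

/-- **The Prop-1.2.3 binders `hinjw` / `hexw` at a factor field `L ⊇ ℚ_v`** for the tower representation, from the
cite facts `cupLogInjective_and_hasDualExp_of_isDeRham` (Kato II Prop. 1.2.3, any de Rham `V`) and
`isDeRham_restrictedRationalTateRep` (via `isDeRham_localRationalTateRep_comp_of_facts`).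
[cite: Kato1993LNM1553, Ch. II Prop. 1.2.3 and Ex. 1.3.5] [cite: BrinonConrad2009, Prop. 6.3.8] -/
theorem hinj_hex_comp_of_facts (hP : cupLogInjective_and_hasDualExp_of_isDeRham)
    (hDR : isDeRham_restrictedRationalTateRep)
    (hcont : Continuous (algebraMap (Place.Completion (Sum.inr v : Place ℚ)) L)) :
    letI := LocalField.padicAlgebra L p hL
    (bdRPeriodRingData (F := L) (p := p) hL).CupLogInjective (logCyclotomic p)
        (localRationalTateRep W p
          ((galRestrictPlace v).comp (absGaloisRestrict (Place.Completion (Sum.inr v : Place ℚ)) L))) ∧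
      ∀ z : contOneCocycles (localRationalTateRep W p
          ((galRestrictPlace v).comp (absGaloisRestrict (Place.Completion (Sum.inr v : Place ℚ)) L))).toTopRep,
        (bdRPeriodRingData (F := L) (p := p) hL).HasDualExp (logCyclotomic p)
          (localRationalTateRep W p
            ((galRestrictPlace v).comp (absGaloisRestrict (Place.Completion (Sum.inr v : Place ℚ)) L)))
          fun σ => z.1 σ := by
  letI := LocalField.padicAlgebra L p hL
  haveI : Module.Finite ℚ_[p] (W.rationalTateModule p) :=
    WeierstrassCurve.module_finite_rationalTateModule_holds W p
  exact hP hL _ (isDeRham_localRationalTateRep_comp_of_facts W p v hL hDR hcont)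

end Summit.BirchSwinnertonDyer.BirchSwinnertonDyer.Theorems.KimAtThreeDeepUpperExpStarFactsTower

end
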